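import Literature.NumberTheory.EllipticCurves.FunctionFieldPlacesResidueField
import Mathlib.Data.Nat.Log
import HarnessLib

/-!
# Places of a global function field: `#(O_v/m_v) = q ^ deg v` (proofs)

Sorry-free discharge of the named fact `Literature.NumberTheory.EllipticCurves.FunctionField.Place.residueCard_eq_pow_degree` of
`Literature.NumberTheory.EllipticCurves.FunctionFieldPlaces`: for every place `v` of a global
function field `F / 𝔽_q(T)`,
`v.residueCard = q ^ v.degree q` with `q = Fintype.card Fq`, i.e. the residue cardinality
`#(O_v/m_v)` is a power of `q`, so that `Place.degree q v := Nat.log q #(O_v/m_v)` is the genuine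
degree `[O_v/m_v : 𝔽_q]`.

## The argument (Rosen, GTM 210, Ch. 5, p. 46)

Rosen defines the degree of a prime `P` of a function field `K/F` (a discrete valuation ring
`R ⊇ F` of `K` with maximal ideal `P`) as `deg P := [R/P : F]`, "the dimension of `R/P` over `F`,
which can be shown to be finite", and sketches the bound `[R/P : F] ≤ [K : F(y)]` for `y ∈ P`
non-constant. That finiteness is `finite_residueField_valuationSubring_of_ne_top`
(`FunctionFieldPlacesResidueField.lean`). This file supplies the remaining bookkeeping over a
finite constant field `𝔽_q`: the constants `𝔽_q ⊂ 𝔽_q(T) ⊂ F` lie in `O_v`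
(`FiniteField.valuation_algebraMap_le_one`), so `O_v/m_v` is an `𝔽_q`-vector space, finite hence
finite-dimensional, so `#(O_v/m_v) = q ^ [O_v/m_v : 𝔽_q]` (`Module.natCard_eq_pow_finrank`), and
`Nat.log q` recovers the exponent since `q ≥ 2`.

## Main results (namespace `Literature.FunctionField`)

* `exists_natCard_residueField_eq_card_pow`: for `F` finite over `RatFunc Fq` (`Fq` finite) and
  `O ⊊ F` a valuation subring, `Nat.card (O/m_O) = (Fintype.card Fq) ^ d` for some `d`
  (namely `d = [O/m_O : 𝔽_q]`).
* `Place.residueCard_eq_pow_degree_holds`: the discharge `residueCard_eq_pow_degree Fq (F := F)`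
  under `[Fintype Fq] [Algebra (RatFunc Fq) F] [FiniteDimensional (RatFunc Fq) F]`.
* `Place.residueCard_pos_of_finiteDimensional`, `Place.degree_pos_of_finiteDimensional`:
  the corollaries `0 < #(O_v/m_v)` and `0 < deg v`.

## On the statement of `residueCard_eq_pow_degree`

As for its siblings (see the module docstrings of `FunctionFieldPlacesResidueField.lean` and
`FunctionFieldPlacesProofs.lean`), the named fact elaborates as
`(Fq : Type) → [Fintype Fq] → {F : Type} → [Field F] → Prop`: the `include Fq` of its section is
inert for `def`s, so the function-field binders `[Field Fq] [Algebra (RatFunc Fq) F]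
[FunctionField Fq F]` are not part of it and it is the bare predicate "every place of `F` has
residue cardinality `#Fq ^ deg`", false for some fields (`Place.not_residueCard_eq_pow_degree` in
`FunctionFieldPlacesProofs.lean`) and true for global function fields over `𝔽_q`, the reading its
docstring intends. Accordingly the discharge carries the global-function-field structure as
hypotheses and proves `residueCard_eq_pow_degree Fq (F := F)`; a consumer
`(h : residueCard_eq_pow_degree Fq (F := F))` working over `[FunctionField Fq F]` is fed by
`Place.residueCard_eq_pow_degree_holds Fq` (see the closing `example`). The def is untouched.

## References

* M. Rosen, *Number Theory in Function Fields*, GTM 210, Springer 2002, Ch. 5, p. 46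
  (`deg P := [R/P : F]`, "which can be shown to be finite", and the sketch
  `[R/P : F] ≤ [K : F(y)]`). [RosenFunctionFields2002]
* H. Stichtenoth, *Algebraic Function Fields and Codes*, GTM 254, Def. I.1.14, Prop. I.1.15.
-/

noncomputable section

open scoped Classical Polynomial

namespace Literature.NumberTheory.EllipticCurves.FunctionField

section ResidueCard

/-- Over a finite constant field the residue field of a valuation subring `O ⊊ F` of a finite
extension `F / 𝔽_q(T)` has `q`-power order: `#(O/m_O) = q ^ d` with `d = [O/m_O : 𝔽_q]`, the
`𝔽_q`-structure coming from `𝔽_q → 𝔽_q(T) → F`, whose image lies in `O`. This is Rosen's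
`deg P := [O_P/P : 𝔽] < ∞` (*Number Theory in Function Fields*, GTM 210, Ch. 5, p. 46) read
through `#V = q ^ dim V` for a finite-dimensional `𝔽_q`-space; the finiteness itself is
`finite_residueField_valuationSubring_of_ne_top`. [cite: RosenFunctionFields2002, Ch. 5, p. 46] -/
theorem exists_natCard_residueField_eq_card_pow (Fq : Type) [Field Fq] [Fintype Fq]
    {F : Type} [Field F] [Algebra (RatFunc Fq) F] [FiniteDimensional (RatFunc Fq) F]
    (O : ValuationSubring F) (hO : O ≠ ⊤) :
    ∃ d : ℕ, Nat.card (IsLocalRing.ResidueField O) = Fintype.card Fq ^ d := by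
  haveI : Finite (IsLocalRing.ResidueField O) :=
    finite_residueField_valuationSubring_of_ne_top (Fq := Fq) O hO
  -- the constants lie in `O`
  have hconstO : ∀ a : Fq, algebraMap (RatFunc Fq) F (algebraMap Fq (RatFunc Fq) a) ∈ O :=
    fun a => (O.valuation_le_one_iff _).mp
      (FiniteField.valuation_algebraMap_le_one (O.valuation.comap (algebraMap (RatFunc Fq) F)) a)
  -- `O/m_O` as an `Fq`-algebra through `Fq → Fq(T) → F ⊇ O → O/m_O`
  letI : Algebra Fq (IsLocalRing.ResidueField O) :=
    ((IsLocalRing.residue O).comp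
      (((algebraMap (RatFunc Fq) F).comp (algebraMap Fq (RatFunc Fq))).codRestrict O
        hconstO)).toAlgebra
  exact ⟨Module.finrank Fq (IsLocalRing.ResidueField O), by
    rw [Module.natCard_eq_pow_finrank (K := Fq), Nat.card_eq_fintype_card]⟩

/-- **Discharge** of the named fact `Place.residueCard_eq_pow_degree` for global function fields:
if `F` is a finite extension of `𝔽_q(T)` (`Fq` finite with `q` elements), then for every place `v`
of `F`, `#(O_v/m_v) = q ^ deg v` where `deg v = Place.degree q v = Nat.log q #(O_v/m_v)`; indeed
`#(O_v/m_v) = q ^ [O_v/m_v : 𝔽_q]` (`exists_natCard_residueField_eq_card_pow`, Rosen GTM 210,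
Ch. 5, p. 46: `deg P := [O_P/P : 𝔽]`, finite) and `Nat.log q (q ^ d) = d` as `1 < q`. Only the
`RatFunc Fq`-algebra structure and finite-dimensionality are used, so the statement omits the
`Fq[X]`-algebra part of the `[FunctionField Fq F]` instance stack (it applies verbatim in that
context, see the `example` below). [cite: RosenFunctionFields2002, Ch. 5, p. 46] -/
theorem Place.residueCard_eq_pow_degree_holds (Fq : Type) [Field Fq] [Fintype Fq] {F : Type}
    [Field F] [Algebra (RatFunc Fq) F] [FiniteDimensional (RatFunc Fq) F] :
    Place.residueCard_eq_pow_degree Fq (F := F) := fun v => by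
  obtain ⟨d, hd⟩ := exists_natCard_residueField_eq_card_pow Fq v.1 v.2.1
  rw [Place.degree, Place.residueCard, hd, Nat.log_pow Fintype.one_lt_card]

/-- Corollary: the residue cardinality of a place of a global function field is positive (the
residue field is finite, so `Nat.card` is not the junk value `0`).
[cite: RosenFunctionFields2002, Ch. 5, p. 46] -/
theorem Place.residueCard_pos_of_finiteDimensional (Fq : Type) [Field Fq] [Fintype Fq]
    {F : Type} [Field F] [Algebra (RatFunc Fq) F] [FiniteDimensional (RatFunc Fq) F]
    (v : Place F) : 0 < v.residueCard := by
  rw [Place.residueCard_eq_pow_degree_holds Fq v]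
  exact pow_pos Fintype.card_pos _

/-- Corollary: every place of a global function field has positive degree `deg v ≥ 1` over `𝔽_q`
(the residue field contains the image of `𝔽_q`, and is a field, so `#(O_v/m_v) ≥ 2`, whence
`q ^ deg v = #(O_v/m_v) > 1`). [cite: RosenFunctionFields2002, Ch. 5, p. 46] -/
theorem Place.degree_pos_of_finiteDimensional (Fq : Type) [Field Fq] [Fintype Fq]
    {F : Type} [Field F] [Algebra (RatFunc Fq) F] [FiniteDimensional (RatFunc Fq) F]
    (v : Place F) : 0 < v.degree (Fintype.card Fq) := by
  haveI : Finite Fq := Finite.of_fintype Fq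
  have h1 : 1 < v.residueCard := Place.one_lt_residueCard_holds Fq v
  rw [Place.residueCard_eq_pow_degree_holds Fq v] at h1
  by_contra h0
  rw [Nat.eq_zero_of_not_pos h0, pow_zero] at h1
  exact lt_irrefl 1 h1

/- Sanity check: the discharge applies over the full instance stack used in
`FunctionFieldPlaces` (`[Fintype Fq] [Algebra Fq[X] F] [Algebra (RatFunc Fq) F]
[IsScalarTower Fq[X] (RatFunc Fq) F] [FunctionField Fq F]`), feeding any consumer
`(h : Place.residueCard_eq_pow_degree Fq (F := F))`. -/
example (Fq : Type) [Field Fq] [Fintype Fq] (F : Type) [Field F] [Algebra Fq[X] F]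
    [Algebra (RatFunc Fq) F] [IsScalarTower Fq[X] (RatFunc Fq) F] [FunctionField Fq F] :
    Place.residueCard_eq_pow_degree Fq (F := F) :=
  Place.residueCard_eq_pow_degree_holds Fq

end ResidueCard

end Literature.NumberTheory.EllipticCurves.FunctionField
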